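import Literature.MathematicalPhysics.QuantumManyBody.CouplingPathSliceFloor
import Literature.MathematicalPhysics.QuantumManyBody.PeriodicBoseGasLemma33
import Literature.MathematicalPhysics.QuantumManyBody.PeriodicFeynmanKacEnergyLower
import Mathlib.Analysis.Calculus.ParametricIntegral
import HarnessLib

/-!
# Crux `CorrectorClosure` (stmt-AtomisticToContinuum-12058), line `healing-scale-kac-insertion` —
tools for the registered sub-goal `hMinusOneSqW_tail_modes_le` of the heart `stub_kacClosure`, I:
trigonometric modes of the tagged coordinate and mode coefficients of a test function

Supports (does not close) stmt-AtomisticToContinuum-12058, route `BECInsertionCorrector`; proves the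
registered sub-goal `pderiv_modeCoeff` and the one-coordinate analysis consumed by
`BECInsertionCorrectorCorrectorClosureTailModes.lean` (the `H₋₁` bound for a finite family of
tagged-coordinate Fourier modes over a product weight), in the weighted-corrector vocabulary of
`Literature/MathematicalPhysics/QuantumManyBody/WeightedCorrector.lean`:

* the real modes `cos(p_n·y)`, `sin(p_n·y)`, `p_n = 2πn/L`, of one coordinate `y ∈ ℝ³`: their cell
  integrals (`∫_{[0,L)³} cos(p_n·y) dy = [n = 0] L³`, `∫ sin(p_n·y) dy = 0`, read off the complex
  plane waves `cellWave`) and the ORTHOGONALITY RELATIONS on a set `S ⊂ ℤ³` of frequencies without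
  antipodal pairs (`m ∈ S ⇒ -m ∉ S`): `∫ cos_m cos_{m'} = ∫ sin_m sin_{m'} = [m = m'] L³/2`,
  `∫ cos_m sin_{m'} = 0` (product-to-sum formulas);
* BESSEL's inequality `∑ᵢ (∫ eᵢ f)² ≤ c ∫ f²` for a finite family with `∫ eᵢ eⱼ = [i = j] c`
  (elementary: `0 ≤ ∫ (c f - ∑ᵢ ⟨eᵢ, f⟩ eᵢ)²`);
* the MODE COEFFICIENTS `X' ↦ ∫_{[0,L)³} w(y) φ(y, X') dy` of a periodic test function `φ` on
  `(ℝ³)^{N+1}` against a continuous weight `w`: they are periodic test functions on the bath torus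
  `(ℝ³)^N`, with `∂_{j,k} ∫ w(y) φ(y, X') dy = ∫ w(y) ∂_{j+1,k} φ(y, X') dy` — differentiation under
  the integral sign (`hasFDerivAt_integral_of_dominated_of_fderiv_le`), dominated by the global
  bound of the continuous periodic gradient `Dφ`, continuity of the derivative by dominated
  convergence.
-/

noncomputable section

open MeasureTheory Matrix
open scoped ENNReal NNReal BigOperators

namespace Summit.AtomisticToContinuum.BoseEinsteinCondensation.Theorems.CorrectorClosure.HealingScaleKacInsertion

open Literature.MathematicalPhysics.QuantumManyBody.BoseGas

variable {N : ℕ} {L : ℝ}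

/-! ### Trigonometric modes of one coordinate on the cell -/

/-- The phase `p_n·y = (2π/L) ∑ᵢ nᵢ yᵢ` is continuous in `y`. [folklore] -/
theorem continuous_modePhase (L : ℝ) (n : Fin 3 → ℤ) :
    Continuous fun y : Space => 2 * Real.pi / L * ∑ i, (n i : ℝ) * y i :=
  continuous_const.mul (continuous_finsetSum _ fun i _ =>
    continuous_const.mul (PiLp.continuous_apply 2 _ i))

/-- `y ↦ cos(p_n·y)` is continuous. [folklore] -/
theorem continuous_cos_modePhase (L : ℝ) (n : Fin 3 → ℤ) :
    Continuous fun y : Space => Real.cos (2 * Real.pi / L * ∑ i, (n i : ℝ) * y i) :=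
  Real.continuous_cos.comp (continuous_modePhase L n)

/-- `y ↦ sin(p_n·y)` is continuous. [folklore] -/
theorem continuous_sin_modePhase (L : ℝ) (n : Fin 3 → ℤ) :
    Continuous fun y : Space => Real.sin (2 * Real.pi / L * ∑ i, (n i : ℝ) * y i) :=
  Real.continuous_sin.comp (continuous_modePhase L n)

/-- `Re e_n(y) = cos(p_n·y)`. [folklore] -/
theorem cellWave_re_eq_cos (L : ℝ) (n : Fin 3 → ℤ) (y : Space) :
    (cellWave L n y).re = Real.cos (2 * Real.pi / L * ∑ i, (n i : ℝ) * y i) := by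
  have h : cellWave L n y =
      Complex.exp (((2 * Real.pi / L * ∑ i, (n i : ℝ) * y i : ℝ) : ℂ) * Complex.I) := by
    rw [cellWave_apply]
    congr 1
    push_cast
    ring
  rw [h, Complex.exp_ofReal_mul_I_re]

/-- `Im e_n(y) = sin(p_n·y)`. [folklore] -/
theorem cellWave_im_eq_sin (L : ℝ) (n : Fin 3 → ℤ) (y : Space) :
    (cellWave L n y).im = Real.sin (2 * Real.pi / L * ∑ i, (n i : ℝ) * y i) := by
  have h : cellWave L n y =
      Complex.exp (((2 * Real.pi / L * ∑ i, (n i : ℝ) * y i : ℝ) : ℂ) * Complex.I) := by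
    rw [cellWave_apply]
    congr 1
    push_cast
    ring
  rw [h, Complex.exp_ofReal_mul_I_im]

/-- `∫_{[0,L)³} cos(p_n·y) dy = [n = 0] L³` (real part of `∫ e_n`). [folklore] -/
theorem integral_cell_cos_modePhase (hL : 0 < L) (n : Fin 3 → ℤ) :
    ∫ y in cell L, Real.cos (2 * Real.pi / L * ∑ i, (n i : ℝ) * y i) =
      if n = 0 then L ^ 3 else 0 := by
  have hint : Integrable (cellWave L n) (volume.restrict (cell L)) :=
    integrableOn_cell (continuous_cellWave L n)
  have h := Complex.reCLM.integral_comp_comm hint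
  simp only [Complex.reCLM_apply, cellWave_re_eq_cos] at h
  rw [h]
  by_cases hn : n = 0
  · rw [if_pos hn, hn, integral_cell_cellWave_zero hL, ← Complex.ofReal_pow, Complex.ofReal_re]
  · rw [if_neg hn, integral_cell_cellWave_eq_zero hL hn, Complex.zero_re]

/-- `∫_{[0,L)³} sin(p_n·y) dy = 0` (imaginary part of `∫ e_n`). [folklore] -/
theorem integral_cell_sin_modePhase (hL : 0 < L) (n : Fin 3 → ℤ) :
    ∫ y in cell L, Real.sin (2 * Real.pi / L * ∑ i, (n i : ℝ) * y i) = 0 := by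
  have hint : Integrable (cellWave L n) (volume.restrict (cell L)) :=
    integrableOn_cell (continuous_cellWave L n)
  have h := Complex.imCLM.integral_comp_comm hint
  simp only [Complex.imCLM_apply, cellWave_im_eq_sin] at h
  rw [h]
  by_cases hn : n = 0
  · rw [hn, integral_cell_cellWave_zero hL, ← Complex.ofReal_pow, Complex.ofReal_im]
  · rw [integral_cell_cellWave_eq_zero hL hn, Complex.zero_im]

/-- Phases add: `p_{m+m'}·y = p_m·y + p_{m'}·y`. [folklore] -/
theorem modePhase_add (L : ℝ) (m m' : Fin 3 → ℤ) (y : Space) :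
    2 * Real.pi / L * ∑ i, (((m + m') i : ℤ) : ℝ) * y i =
      2 * Real.pi / L * ∑ i, (m i : ℝ) * y i + 2 * Real.pi / L * ∑ i, (m' i : ℝ) * y i := by
  simp only [Pi.add_apply, Int.cast_add, add_mul, Finset.sum_add_distrib, mul_add]

/-- Phases subtract: `p_{m-m'}·y = p_m·y - p_{m'}·y`. [folklore] -/
theorem modePhase_sub (L : ℝ) (m m' : Fin 3 → ℤ) (y : Space) :
    2 * Real.pi / L * ∑ i, (((m - m') i : ℤ) : ℝ) * y i =
      2 * Real.pi / L * ∑ i, (m i : ℝ) * y i - 2 * Real.pi / L * ∑ i, (m' i : ℝ) * y i := by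
  simp only [Pi.sub_apply, Int.cast_sub, sub_mul, Finset.sum_sub_distrib, mul_sub]

/-- **Orthogonality of the cosine modes** on a set of frequencies without antipodal pairs:
`∫_{[0,L)³} cos(p_m·y) cos(p_{m'}·y) dy = [m = m'] L³/2` for `m, m' ∈ S`. [folklore] -/
theorem integral_cell_cos_mul_cos (hL : 0 < L) {S : Finset (Fin 3 → ℤ)} (hS : ∀ m ∈ S, -m ∉ S)
    {m m' : Fin 3 → ℤ} (hm : m ∈ S) (hm' : m' ∈ S) :
    ∫ y in cell L, Real.cos (2 * Real.pi / L * ∑ i, (m i : ℝ) * y i) *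
        Real.cos (2 * Real.pi / L * ∑ i, (m' i : ℝ) * y i) =
      if m = m' then L ^ 3 / 2 else 0 := by
  have hsum : m + m' ≠ 0 := fun h => hS m hm ((eq_neg_of_add_eq_zero_right h) ▸ hm')
  have hpt : ∀ y : Space, Real.cos (2 * Real.pi / L * ∑ i, (m i : ℝ) * y i) *
      Real.cos (2 * Real.pi / L * ∑ i, (m' i : ℝ) * y i) =
        (Real.cos (2 * Real.pi / L * ∑ i, (((m - m') i : ℤ) : ℝ) * y i) +
          Real.cos (2 * Real.pi / L * ∑ i, (((m + m') i : ℤ) : ℝ) * y i)) / 2 := by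
    intro y
    rw [modePhase_sub, modePhase_add, Real.cos_sub, Real.cos_add]
    ring
  simp_rw [hpt]
  rw [integral_div, integral_add (integrableOn_cell (continuous_cos_modePhase L _))
    (integrableOn_cell (continuous_cos_modePhase L _)), integral_cell_cos_modePhase hL,
    integral_cell_cos_modePhase hL, if_neg hsum, add_zero]
  by_cases h : m = m'
  · rw [if_pos h, if_pos (sub_eq_zero.2 h)]
  · rw [if_neg h, if_neg (sub_ne_zero.2 h), zero_div]

/-- **Orthogonality of the sine modes**: `∫_{[0,L)³} sin(p_m·y) sin(p_{m'}·y) dy = [m = m'] L³/2`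
for `m, m' ∈ S`, `S` without antipodal pairs. [folklore] -/
theorem integral_cell_sin_mul_sin (hL : 0 < L) {S : Finset (Fin 3 → ℤ)} (hS : ∀ m ∈ S, -m ∉ S)
    {m m' : Fin 3 → ℤ} (hm : m ∈ S) (hm' : m' ∈ S) :
    ∫ y in cell L, Real.sin (2 * Real.pi / L * ∑ i, (m i : ℝ) * y i) *
        Real.sin (2 * Real.pi / L * ∑ i, (m' i : ℝ) * y i) =
      if m = m' then L ^ 3 / 2 else 0 := by
  have hsum : m + m' ≠ 0 := fun h => hS m hm ((eq_neg_of_add_eq_zero_right h) ▸ hm')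
  have hpt : ∀ y : Space, Real.sin (2 * Real.pi / L * ∑ i, (m i : ℝ) * y i) *
      Real.sin (2 * Real.pi / L * ∑ i, (m' i : ℝ) * y i) =
        (Real.cos (2 * Real.pi / L * ∑ i, (((m - m') i : ℤ) : ℝ) * y i) -
          Real.cos (2 * Real.pi / L * ∑ i, (((m + m') i : ℤ) : ℝ) * y i)) / 2 := by
    intro y
    rw [modePhase_sub, modePhase_add, Real.cos_sub, Real.cos_add]
    ring
  simp_rw [hpt]
  rw [integral_div, integral_sub (integrableOn_cell (continuous_cos_modePhase L _))
    (integrableOn_cell (continuous_cos_modePhase L _)), integral_cell_cos_modePhase hL,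
    integral_cell_cos_modePhase hL, if_neg hsum, sub_zero]
  by_cases h : m = m'
  · rw [if_pos h, if_pos (sub_eq_zero.2 h)]
  · rw [if_neg h, if_neg (sub_ne_zero.2 h), zero_div]

/-- **Cosine and sine modes are orthogonal**: `∫_{[0,L)³} cos(p_m·y) sin(p_{m'}·y) dy = 0`.
[folklore] -/
theorem integral_cell_cos_mul_sin (hL : 0 < L) (m m' : Fin 3 → ℤ) :
    ∫ y in cell L, Real.cos (2 * Real.pi / L * ∑ i, (m i : ℝ) * y i) *
        Real.sin (2 * Real.pi / L * ∑ i, (m' i : ℝ) * y i) = 0 := by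
  have hpt : ∀ y : Space, Real.cos (2 * Real.pi / L * ∑ i, (m i : ℝ) * y i) *
      Real.sin (2 * Real.pi / L * ∑ i, (m' i : ℝ) * y i) =
        (Real.sin (2 * Real.pi / L * ∑ i, (((m + m') i : ℤ) : ℝ) * y i) -
          Real.sin (2 * Real.pi / L * ∑ i, (((m - m') i : ℤ) : ℝ) * y i)) / 2 := by
    intro y
    rw [modePhase_sub, modePhase_add, Real.sin_sub, Real.sin_add]
    ring
  simp_rw [hpt]
  rw [integral_div, integral_sub (integrableOn_cell (continuous_sin_modePhase L _))
    (integrableOn_cell (continuous_sin_modePhase L _)), integral_cell_sin_modePhase hL,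
    integral_cell_sin_modePhase hL, sub_zero, zero_div]

/-! ### Bessel's inequality for a finite orthogonal family on the cell -/

/-- **Bessel's inequality for a finite orthogonal family of continuous functions on the cell**:
if `∫_{[0,L)³} eᵢ eⱼ = [i = j] c` (`c > 0`) on the index set `T`, then
`∑_{i ∈ T} (∫ eᵢ f)² ≤ c ∫ f²` for continuous `f` (expand `0 ≤ ∫ (c f - ∑ᵢ ⟨eᵢ, f⟩ eᵢ)²`).
[folklore] -/
theorem sum_sq_integral_mul_le_of_orthogonal {ι : Type*} [DecidableEq ι] (T : Finset ι)
    {e : ι → Space → ℝ} (he : ∀ i ∈ T, Continuous (e i)) {f : Space → ℝ} (hf : Continuous f)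
    {c : ℝ} (hc : 0 < c)
    (horth : ∀ i ∈ T, ∀ j ∈ T, ∫ y in cell L, e i y * e j y = if i = j then c else 0) :
    ∑ i ∈ T, (∫ y in cell L, e i y * f y) ^ 2 ≤ c * ∫ y in cell L, f y ^ 2 := by
  have hI : ∀ {u : Space → ℝ}, Continuous u → Integrable u (volume.restrict (cell L)) :=
    fun hu => integrableOn_cell hu
  -- the coefficients `A i = ⟨e_i, f⟩` and the projection `g = ∑ A_i e_i`
  obtain ⟨A, hA⟩ : ∃ A : ι → ℝ, ∀ i, A i = ∫ y in cell L, e i y * f y := ⟨_, fun _ => rfl⟩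
  obtain ⟨g, hg⟩ : ∃ g : Space → ℝ, ∀ y, g y = ∑ i ∈ T, A i * e i y := ⟨_, fun _ => rfl⟩
  have hgc : Continuous g := by
    rw [show g = fun y => ∑ i ∈ T, A i * e i y from funext hg]
    exact continuous_finsetSum _ fun i hi => (continuous_const (y := A i)).mul (he i hi)
  -- `∫ f g = ∑ Aᵢ²`
  have h1 : ∫ y in cell L, f y * g y = ∑ i ∈ T, A i ^ 2 := by
    have hpt : ∀ y, f y * g y = ∑ i ∈ T, A i * (e i y * f y) := fun y => by
      rw [hg, Finset.mul_sum]
      exact Finset.sum_congr rfl fun i _ => by ring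
    simp_rw [hpt]
    rw [integral_finsetSum]
    · exact Finset.sum_congr rfl fun i _ => by rw [integral_const_mul, ← hA, sq]
    · intro i hi
      exact (hI ((he i hi).mul hf)).const_mul (A i)
  -- `∫ g² = c ∑ Aᵢ²`
  have h2 : ∫ y in cell L, g y ^ 2 = c * ∑ i ∈ T, A i ^ 2 := by
    have hpt : ∀ y, g y ^ 2 = ∑ i ∈ T, ∑ j ∈ T, A i * A j * (e i y * e j y) := fun y => by
      rw [hg, sq, Finset.sum_mul_sum]
      exact Finset.sum_congr rfl fun i _ => Finset.sum_congr rfl fun j _ => by ring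
    simp_rw [hpt]
    have hij : ∀ i ∈ T, ∀ j ∈ T,
        Integrable (fun y => A i * A j * (e i y * e j y)) (volume.restrict (cell L)) :=
      fun i hi j hj => (hI ((he i hi).mul (he j hj))).const_mul _
    rw [integral_finsetSum _ fun i hi => integrable_finsetSum _ fun j hj => hij i hi j hj,
      Finset.mul_sum]
    refine Finset.sum_congr rfl fun i hi => ?_
    rw [integral_finsetSum _ fun j hj => hij i hi j hj]
    simp_rw [integral_const_mul]
    rw [Finset.sum_eq_single i (fun j hj hji => by
      rw [horth i hi j hj, if_neg (Ne.symm hji), mul_zero]) (fun h => (h hi).elim),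
      horth i hi i hi, if_pos rfl]
    ring
  -- `0 ≤ ∫ (c f - g)² = c² ∫ f² - 2 c ∑ Aᵢ² + c ∑ Aᵢ²`
  have h3 : 0 ≤ ∫ y in cell L, (c * f y - g y) ^ 2 := integral_nonneg fun y => sq_nonneg _
  have h4 : ∫ y in cell L, (c * f y - g y) ^ 2 =
      c ^ 2 * (∫ y in cell L, f y ^ 2) - 2 * c * (∫ y in cell L, f y * g y) +
        ∫ y in cell L, g y ^ 2 := by
    have hpt : ∀ y, (c * f y - g y) ^ 2 =
        c ^ 2 * f y ^ 2 - 2 * c * (f y * g y) + g y ^ 2 := fun y => by ring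
    simp_rw [hpt]
    rw [integral_add, integral_sub, integral_const_mul, integral_const_mul]
    all_goals exact hI (by fun_prop)
  rw [h4, h1, h2] at h3
  simp_rw [← hA]
  refine le_of_mul_le_mul_left ?_ hc
  nlinarith [h3]

/-! ### Mode coefficients of a test function: differentiation under the integral sign -/

/-- The slice map `X' ↦ (y, X')` has derivative the bath insertion `X' ↦ (0, X')`, written as the
continuous linear map `consEquivL ∘ inr : (ℝ³)^N →L (ℝ³)^{N+1}`. [folklore] -/
theorem hasFDerivAt_vecCons_right (y : Space) (Z : Config N) :
    HasFDerivAt (fun W : Config N => (Matrix.vecCons y W : Config (N + 1)))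
      (((Fin.consEquivL ℝ (fun _ : Fin (N + 1) => Space)) :
          Space × Config N →L[ℝ] Config (N + 1)).comp
        (ContinuousLinearMap.inr ℝ Space (Config N))) Z := by
  have h : (fun W : Config N => (Matrix.vecCons y W : Config (N + 1))) =
      (Fin.consEquivL ℝ (fun _ : Fin (N + 1) => Space)) ∘ fun W : Config N => (y, W) := by
    funext W
    rfl
  rw [h]
  exact (Fin.consEquivL ℝ (fun _ : Fin (N + 1) => Space)).hasFDerivAt.comp Z
    (hasFDerivAt_prodMk_right y Z)

/-- The bath insertion maps `e_j ⊗ u` to `e_{j+1} ⊗ u`: `(0, e_j ⊗ u) = e_{j+1} ⊗ u`. [folklore] -/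
theorem consEquivL_comp_inr_single (j : Fin N) (u : Space) :
    (((Fin.consEquivL ℝ (fun _ : Fin (N + 1) => Space)) :
          Space × Config N →L[ℝ] Config (N + 1)).comp
        (ContinuousLinearMap.inr ℝ Space (Config N))) (Pi.single j u) = Pi.single j.succ u := by
  rw [← vecCons_zero_single]
  rfl

/-- The gradient of a periodic test function is globally bounded (continuous and periodic).
[folklore] -/
theorem exists_norm_fderiv_le_of_isPeriodicTest {M : ℕ} (hL : 0 < L) {φ : Config M → ℝ}
    (hφ : IsPeriodicTest L φ) : ∃ C : ℝ, 0 ≤ C ∧ ∀ X, ‖fderiv ℝ φ X‖ ≤ C := by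
  obtain ⟨C, hC0, hC⟩ := exists_bound_of_continuous_periodic hL
    (hφ.contDiff.continuous_fderiv one_ne_zero).norm
    (fun X i k => by simp only [fderiv_periodic hφ.2])
  exact ⟨C, hC0, fun X => (le_abs_self _).trans (hC X)⟩

/-- **Differentiation under the integral sign for the mode coefficients.** For a periodic test
function `φ` on `(ℝ³)^{N+1}` and a continuous weight `w` on `ℝ³`, the bath function
`X' ↦ ∫_{[0,L)³} w(y) φ(y, X') dy` has Fréchet derivative `∫ w(y) Dφ(y, X') ∘ J dy`, `J` the
derivative of the slice maps `X' ↦ (y, X')` (dominated by the global bound of `Dφ`). [folklore] -/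
theorem hasFDerivAt_modeCoeff (hL : 0 < L) {φ : Config (N + 1) → ℝ} (hφ : IsPeriodicTest L φ)
    {w : Space → ℝ} (hw : Continuous w) {J : Config N →L[ℝ] Config (N + 1)}
    (hJ : ∀ (y : Space) (W : Config N),
      HasFDerivAt (fun W : Config N => (Matrix.vecCons y W : Config (N + 1))) J W) (Z : Config N) :
    HasFDerivAt (fun W : Config N => ∫ y in cell L, w y * φ (Matrix.vecCons y W))
      (∫ y in cell L, w y • (fderiv ℝ φ (Matrix.vecCons y Z)).comp J) Z := by
  obtain ⟨C, hC0, hC⟩ := exists_norm_fderiv_le_of_isPeriodicTest hL hφ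
  have hφd : Differentiable ℝ φ := hφ.differentiable
  have hφ' : Continuous (fderiv ℝ φ) := hφ.contDiff.continuous_fderiv one_ne_zero
  have hcl : ∀ W : Config N, Continuous fun y : Space => (Matrix.vecCons y W : Config (N + 1)) :=
    fun W => continuous_id.matrixVecCons continuous_const
  refine hasFDerivAt_integral_of_dominated_of_fderiv_le (𝕜 := ℝ) (μ := volume.restrict (cell L))
    (F := fun (W : Config N) (y : Space) => w y * φ (Matrix.vecCons y W))
    (F' := fun (W : Config N) (y : Space) => w y • (fderiv ℝ φ (Matrix.vecCons y W)).comp J)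
    (bound := fun y => |w y| * (C * ‖J‖)) (s := Set.univ) Filter.univ_mem ?_ ?_ ?_ ?_ ?_ ?_
  · exact Filter.Eventually.of_forall fun W =>
      (hw.mul (hφ.continuous.comp (hcl W))).aestronglyMeasurable
  · exact integrableOn_cell (hw.mul (hφ.continuous.comp (hcl Z)))
  · exact (hw.smul ((hφ'.comp (hcl Z)).clm_comp_const _)).aestronglyMeasurable
  · refine Filter.Eventually.of_forall fun y W _ => ?_
    rw [norm_smul, Real.norm_eq_abs]
    refine mul_le_mul_of_nonneg_left ?_ (abs_nonneg _)
    exact (ContinuousLinearMap.opNorm_comp_le _ _).trans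
      (mul_le_mul_of_nonneg_right (hC _) (norm_nonneg _))
  · exact integrableOn_cell ((continuous_abs.comp hw).mul continuous_const)
  · refine Filter.Eventually.of_forall fun y W _ => ?_
    exact ((hφd _).hasFDerivAt.comp W (hJ y W)).const_mul (w y)

/-- The candidate derivative `X' ↦ ∫ w(y) Dφ(y, X') ∘ J dy` of the mode coefficient is continuous,
for any continuous linear `J` (dominated convergence, same global bound). [folklore] -/
theorem continuous_fderiv_modeCoeff (hL : 0 < L) {φ : Config (N + 1) → ℝ}
    (hφ : IsPeriodicTest L φ) {w : Space → ℝ} (hw : Continuous w)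
    (J : Config N →L[ℝ] Config (N + 1)) :
    Continuous fun Z : Config N =>
      ∫ y in cell L, w y • (fderiv ℝ φ (Matrix.vecCons y Z)).comp J := by
  obtain ⟨C, hC0, hC⟩ := exists_norm_fderiv_le_of_isPeriodicTest hL hφ
  have hφ' : Continuous (fderiv ℝ φ) := hφ.contDiff.continuous_fderiv one_ne_zero
  have hcl : ∀ W : Config N, Continuous fun y : Space => (Matrix.vecCons y W : Config (N + 1)) :=
    fun W => continuous_id.matrixVecCons continuous_const
  have hcr : ∀ y : Space, Continuous fun W : Config N => (Matrix.vecCons y W : Config (N + 1)) :=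
    fun y => continuous_const.matrixVecCons continuous_id
  refine continuous_of_dominated
    (F := fun (W : Config N) (y : Space) => w y • (fderiv ℝ φ (Matrix.vecCons y W)).comp J)
    (bound := fun y => |w y| * (C * ‖J‖)) ?_ ?_ ?_ ?_
  · exact fun W => (hw.smul ((hφ'.comp (hcl W)).clm_comp_const _)).aestronglyMeasurable
  · refine fun W => Filter.Eventually.of_forall fun y => ?_
    rw [norm_smul, Real.norm_eq_abs]
    refine mul_le_mul_of_nonneg_left ?_ (abs_nonneg _)
    exact (ContinuousLinearMap.opNorm_comp_le _ _).trans
      (mul_le_mul_of_nonneg_right (hC _) (norm_nonneg _))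
  · exact integrableOn_cell ((continuous_abs.comp hw).mul continuous_const)
  · exact Filter.Eventually.of_forall fun y =>
      ((hφ'.comp (hcr y)).clm_comp_const J).fun_const_smul (w y)

/-- **The mode coefficients are periodic test functions** on the bath torus: for a periodic test
`φ` on `(ℝ³)^{N+1}` and continuous `w`, `X' ↦ ∫_{[0,L)³} w(y) φ(y, X') dy` is `C¹` and
`Lℤ³`-periodic in every bath particle. [folklore] -/
theorem isPeriodicTest_modeCoeff (hL : 0 < L) {φ : Config (N + 1) → ℝ} (hφ : IsPeriodicTest L φ)
    {w : Space → ℝ} (hw : Continuous w) :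
    IsPeriodicTest L (fun Z : Config N => ∫ y in cell L, w y * φ (Matrix.vecCons y Z)) := by
  refine ⟨?_, fun Z j k => ?_⟩
  · rw [contDiff_one_iff_hasFDerivAt]
    exact ⟨_, continuous_fderiv_modeCoeff hL hφ hw _,
      hasFDerivAt_modeCoeff hL hφ hw hasFDerivAt_vecCons_right⟩
  · simp only [vecCons_add_single, hφ.2]

/-- **Derivative of the mode coefficients**:
`∂_{j,k} ∫ w(y) φ(y, X') dy = ∫ w(y) ∂_{j+1,k}φ(y, X') dy`.
[folklore] -/
theorem pderiv_modeCoeff (hL : 0 < L) {φ : Config (N + 1) → ℝ} (hφ : IsPeriodicTest L φ)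
    {w : Space → ℝ} (hw : Continuous w) (Z : Config N) (j : Fin N) (k : Fin 3) :
    pderiv j k (fun W : Config N => ∫ y in cell L, w y * φ (Matrix.vecCons y W)) Z =
      ∫ y in cell L, w y * pderiv j.succ k φ (Matrix.vecCons y Z) := by
  have hφ' : Continuous (fderiv ℝ φ) := hφ.contDiff.continuous_fderiv one_ne_zero
  have hcl : Continuous fun y : Space => (Matrix.vecCons y Z : Config (N + 1)) :=
    continuous_id.matrixVecCons continuous_const
  have hint : Integrable (fun y : Space => w y • (fderiv ℝ φ (Matrix.vecCons y Z)).comp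
      (((Fin.consEquivL ℝ (fun _ : Fin (N + 1) => Space)) :
          Space × Config N →L[ℝ] Config (N + 1)).comp
        (ContinuousLinearMap.inr ℝ Space (Config N)))) (volume.restrict (cell L)) :=
    integrableOn_cell (hw.smul ((hφ'.comp hcl).clm_comp_const _))
  unfold pderiv
  rw [(hasFDerivAt_modeCoeff hL hφ hw hasFDerivAt_vecCons_right Z).fderiv,
    ContinuousLinearMap.integral_apply hint]
  refine integral_congr_ae (Filter.Eventually.of_forall fun y => ?_)
  rw [← consEquivL_comp_inr_single (N := N) j (EuclideanSpace.single k (1 : ℝ))]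
  rfl

end Summit.AtomisticToContinuum.BoseEinsteinCondensation.Theorems.CorrectorClosure.HealingScaleKacInsertion

end
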